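/-
Copyright (c) 2026 the pub-hodgecm-mathlib formalisation cell (harness21).  Prover seat hodgecm-mathlib-K2E1-p15 (g0), Track B ∕ K2-LIT «5Res (c)∕(d)», h413 = `stmt-HodgeConjecture-24833`,
line `K2_E1_TraceFormulaBeta`, route of record `HCCMUnconditional`; DESK-FREE offer (c) on the K2 bus after ★ p860216: the LOWER-HALF-PLANE print of ★ p859971 ∕ ★ p860014 §2 —
«no pole off the real axis» for `Im z < 0` (over ★ p860112 `K2E1ChiMaassSelbergContinuedLowerCMTwo`).
-/
import Summits.HodgeConjecture.HodgeConjecture.Theorems.K2E1ChiMaassSelbergContinuedLowerCMTwo          -- ★ p860112 (this seat): `poleControl_continued_chi_cm_two_of_truncatedFamily_lower_on'`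
import Summits.HodgeConjecture.HodgeConjecture.Theorems.K2E1SphericalEisensteinPoleExclusionCMThree  -- ★ p859741 (K2E1-p11): `countable_ball_diff_of_codiscrete`
import Summits.HodgeConjecture.HodgeConjecture.Theorems.K2E1ConvexDiffCountableConnected            -- ★ p859595 (K2E4-p11): `isPreconnected_convex_diff_of_countable`
import HarnessLib

/-!
# K2·E1 — `K2E1ChiEisensteinPoleExclusionLowerCMTwo`: [MW] IV.3.12 (a) FOR THE `(χ, τ)` INTERTWINING OPERATOR ON THE LOWER DOMAIN `D₁⁻ = (D⁻ ∩ D_n ∩ U) ∖ P`, AND THE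
# PUNCTURED-NEIGHBOURHOOD BOUND OF THE BRACKET NEAR EVERY `z₁` WITH `½ < Re z₁`, `Im z₁ < 0` — the lower-half-plane prints of ★ `K2E1ChiEisensteinPoleExclusionCMTwo` ∕ ★ (d)-assembly §2

Track B ∕ K2-LIT, crux h413 = `stmt-HodgeConjecture-24833`; cell `hodgecm-mathlib`, squad K2, ENGINE E1, campaign «5Res», road «BL-2(χ,τ) ∘ MS-2(χ,τ) ∘ ARCH-UNITARITY ∘ R8₂».
THEOREMS ONLY (no `def`, no `instance`, no notation, no named-fact hypothesis, no `sorry`); lane `--kind proof --supports stmt-HodgeConjecture-24833 --as helper` (count-neutral).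
Closes no socket.

WHAT.  ★ p859971 `chiPoleExclusion_bounds_cm_two` and ★ p860014 `chi_eventually_bracket_le_near_cm_two` give the Maass–Selberg bounds and the punctured-neighbourhood boundedness of the
bracket `b(z) = ‖M(z,χ)φ‖²`-letter at every `z₁` with `½ < Re z₁`, `Im z₁ > 0`; this file is the mirror image `Im z₁ < 0` (domain `D₁⁻ = ({½ < Re, Im < 0} ∩ D_n ∩ U) ∖ P`, boxes
`{3 < Re < 4, −1 < Im < 0}`, `{1 < Re < 2, −1 < Im < 0}`), run through ★ p860112's reflected head `poleControl_continued_chi_cm_two_of_truncatedFamily_lower_on'`.  Together: «NO POLE OF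
THE CONTINUED `(χ, τ)` FAMILY OFF THE REAL AXIS IN `½ < Re z`» for every bracket-dominated matrix entry (★ p860014 §3), both half-planes.
* §1 **`exists_eventually_le_of_boxBound_of_im_ne_zero`** — the (a2)-box ⇒ punctured-neighbourhood bound for ANY `z₁` with `½ < Re z₁`, `Im z₁ ≠ 0` (★ p860014 §1 had `0 < Im z₁`).
* §2 **`chiPoleExclusion_bounds_lower_cm_two`** — (a1)∧(a2)∧(a3) at every `z ∈ D₁⁻` (letters = ★ p859971's with `D⁺ ↦ D⁻`; `Fam` = the row-15 family on `D₁⁻`).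
* §3 **`chi_eventually_bracket_le_near_lower_cm_two`** — `∃ C, ∀ᶠ z in 𝓝[≠] z₁, b z ≤ C` for `½ < Re z₁`, `Im z₁ < 0`, `z₁ ∈ D_n`.
HONEST LABEL: HC_CM is proved only modulo the 7 printed citations (2 remaining named inputs: hLiu418 = `stmt-HodgeConjecture-24832`, h413 = `stmt-HodgeConjecture-24833`) until rung 0
closes; this file asserts no named fact, is conditional by construction on its binders (`Fam`, (E1), `h4`, the bracket letters), and closes no socket.

## References
* [MoeglinWaldspurger1995] C. Mœglin, J.-L. Waldspurger, *Spectral decomposition and Eisenstein series* (1995), IV.2.3, IV.3.12 (a).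
* [BernsteinLapid2019] J. Bernstein, E. Lapid, *On the meromorphic continuation of Eisenstein series*, J. AMS 37 (2024), Thm 2.3, §4.
* [Arthur1980TraceFormulaII] J. Arthur, *A trace formula for reductive groups II*, Compositio Math. 40 (1980), §4.
-/

set_option autoImplicit false
set_option linter.dupNamespace false  -- the mandated namespace repeats the summit's segment (`HodgeConjecture.HodgeConjecture`)

noncomputable section

open MeasureTheory MeasureTheory.Measure Set NumberField IsDedekindDomain Filter Topology
open scoped NNReal ENNReal ComplexConjugate
open Literature.MeasureTheory.Group Literature.NumberTheory
open Literature.NumberTheory.Automorphic Literature.NumberTheory.Automorphic.UnitaryGroup AdelicGroupData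
open Summit.HodgeConjecture.HodgeConjecture.Cruxes.H413.K2E1BorelEisensteinU
open Summit.HodgeConjecture.HodgeConjecture.Cruxes.H413.K2E1ChiMaassSelbergContinuedLowerCMTwo (poleControl_continued_chi_cm_two_of_truncatedFamily_lower_on')
open Summit.HodgeConjecture.HodgeConjecture.Cruxes.H413.K2E1ConvexDiffCountableConnected (isPreconnected_convex_diff_of_countable)
open Summit.HodgeConjecture.HodgeConjecture.Cruxes.H413.K2E1SphericalEisensteinPoleExclusionCMThree (countable_ball_diff_of_codiscrete)

namespace Summit.HodgeConjecture.HodgeConjecture.Cruxes.H413.K2E1ChiEisensteinPoleExclusionLowerCMTwo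

/-! ## §1 Box bound ⇒ punctured-neighbourhood bound, both signs of `Im z₁` -/

/-- **FROM THE BOX BOUND (a2) TO A PUNCTURED-NEIGHBOURHOOD BOUND, `Im z₁ ≠ 0`** — ★ `K2E1ChiEisensteinNoComplexPoleCMTwo.exists_eventually_le_of_boxBound` with `0 < Im z₁` relaxed to
`Im z₁ ≠ 0` (the box `[d∕2, 3d∕2] × {|Im| ≥ |Im z₁|∕2}`, `d = Re z₁ − ½`, contains the disc of radius `min(d, |Im z₁|)∕2` about `z₁`). [cite: MoeglinWaldspurger1995, IV.3.12 (a)] -/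
theorem exists_eventually_le_of_boxBound_of_im_ne_zero {D₁ : Set ℂ} {b : ℂ → ℝ} {a T : ℝ}
    (hbox : ∀ z ∈ D₁, ∀ {x₁ x₂ η : ℝ}, 0 < x₁ → (z.re - 1 / 2) ∈ Set.Icc x₁ x₂ → 0 < η → η ≤ |z.im| →
      b z ≤ (x₂ * T ^ (2 * x₂) * Real.sqrt a / η + Real.sqrt (x₂ ^ 2 * T ^ (4 * x₂) * a / η ^ 2 + a * T ^ (4 * x₂))) ^ 2)
    {z₁ : ℂ} (hz₁ : 1 / 2 < z₁.re ∧ z₁.im ≠ 0) (hev : ∀ᶠ z in 𝓝[≠] z₁, z ∈ D₁) :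
    ∃ C : ℝ, ∀ᶠ z in 𝓝[≠] z₁, b z ≤ C := by
  obtain ⟨h1, h2⟩ := hz₁
  have h2' : 0 < |z₁.im| := abs_pos.2 h2
  set d : ℝ := z₁.re - 1 / 2 with hd
  have hd0 : 0 < d := by rw [hd]; linarith
  set r : ℝ := min d |z₁.im| / 2 with hr
  have hr0 : 0 < r := by rw [hr]; positivity
  refine ⟨(3 * d / 2 * T ^ (2 * (3 * d / 2)) * Real.sqrt a / (|z₁.im| / 2) + Real.sqrt ((3 * d / 2) ^ 2 * T ^ (4 * (3 * d / 2)) * a / (|z₁.im| / 2) ^ 2 + a * T ^ (4 * (3 * d / 2)))) ^ 2, ?_⟩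
  have hball : ∀ᶠ z in 𝓝[≠] z₁, z ∈ Metric.ball z₁ r := mem_nhdsWithin_of_mem_nhds (Metric.ball_mem_nhds z₁ hr0)
  filter_upwards [hev, hball] with z hzD hzb
  have hz : ‖z - z₁‖ < r := by rwa [Metric.mem_ball, dist_eq_norm] at hzb
  have hre : |z.re - z₁.re| < r := lt_of_le_of_lt (by simpa only [Complex.sub_re] using Complex.abs_re_le_norm (z - z₁)) hz
  have him : |z.im - z₁.im| < r := lt_of_le_of_lt (by simpa only [Complex.sub_im] using Complex.abs_im_le_norm (z - z₁)) hz
  have hrd : r ≤ d / 2 := by rw [hr]; exact div_le_div_of_nonneg_right (min_le_left _ _) (by norm_num)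
  have hri : r ≤ |z₁.im| / 2 := by rw [hr]; exact div_le_div_of_nonneg_right (min_le_right _ _) (by norm_num)
  have him' : |z₁.im| / 2 ≤ |z.im| := by
    have := abs_sub_abs_le_abs_sub z₁.im z.im
    rw [abs_sub_comm] at this
    linarith
  rw [abs_lt] at hre
  refine hbox z hzD (x₁ := d / 2) (x₂ := 3 * d / 2) (η := |z₁.im| / 2) (by positivity) ⟨?_, ?_⟩ (by positivity) him'
  · rw [hd] at hrd ⊢; linarith
  · rw [hd] at hrd ⊢; linarith

/-! ## §2 Pole exclusion on the lower domain -/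

section Head

variable (L : Type) [Field L] [NumberField L] [IsCMField L]
  [MeasurableSpace (quasiSplit (↥(maximalRealSubfield L)) L (IsCMField.complexConj L) 2).Adelic]

/-- **POLE EXCLUSION FOR THE `(χ, τ)` DATA AT `N = 2` ON THE LOWER DOMAIN `D₁⁻ = (D⁻ ∩ D_n ∩ U) ∖ P`, `D⁻ = {½ < Re, Im < 0}`** — the twin of ★ `chiPoleExclusion_bounds_cm_two` through ★ `poleControl_continued_chi_cm_two_of_truncatedFamily_lower_on'`: at every `z ∈ D₁`,
(a1) `√b(z) ≤ x·T₀^{2x}·√a∕|y| + √(x²T₀^{4x}a∕y² + aT₀^{4x})`, (a2) the box bound, (a3) `b(z) ≤ (…)²∕y²` for `|y| ≤ 1` (`x = Re z − ½`, `y = Im z`), hypothesis-first on the row-15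
family `Fam` (binders in ★ `exists_truncatedFamily_chi_cm_two_upper`'s conclusion shape), X2_χ's (E1) `hE1`, FILE 1's tube relation `h4` and the continued bracket letters on `D₁`; the
topology of `D₁` (open, preconnected, two sub-tube boxes) is discharged here from `hUo hUcod hPc hPcount (hn : 2 ≤ n)`.
[cite: MoeglinWaldspurger1995, IV.2.3, IV.3.12 (a)] [cite: BernsteinLapid2019, Thm 2.3, §4] [cite: Arthur1980TraceFormulaII, §4] -/
theorem chiPoleExclusion_bounds_lower_cm_two
    (μ : Measure (quasiSplit (↥(maximalRealSubfield L)) L (IsCMField.complexConj L) 2).automorphicQuotient)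
    (ν : Measure ↥(adelicUnipotent (↥(maximalRealSubfield L)) L (IsCMField.complexConj L) 2)) (𝓕 : Set ↥(adelicUnipotent (↥(maximalRealSubfield L)) L (IsCMField.complexConj L) 2))
    -- the ball, the co-discrete holomorphy set `U` (★ X1_χ) and the closed countable exceptional set `P` (★ row 13 ∕ X2_χ)
    (n : ℕ) (hn : 2 ≤ n) {U : Set ℂ} (hUo : IsOpen U) (hUcod : ∀ z₀ ∈ Metric.ball (0 : ℂ) (n + 2), ∀ᶠ s in 𝓝[≠] z₀, s ∈ U)
    {P : Set ℂ} (hPc : IsClosed P) (hPcount : P.Countable)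
    -- the truncation base and the bracket letters of ★ p859658 on `D₁`
    {T₀ : ℝ≥0} (hT₀ : 1 ≤ T₀) {cμ K : ℝ} (hcμ : 0 < cμ) (hK : 0 < K) {a : ℝ} (ha : 0 < a) {b : ℂ → ℝ}
    (hb : ∀ z ∈ ({z : ℂ | 1 / 2 < z.re ∧ z.im < 0} ∩ Metric.ball (0 : ℂ) (n + 2) ∩ U) \ P, 0 ≤ b z)
    {B₁ : ℂ} {B₂ B₃ : ℂ → ℂ} {B₄ : ℂ → ℂ → ℂ} (hB₁ : B₁ = ((a : ℝ) : ℂ))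
    (hB₂ : DifferentiableOn ℂ (fun w : ℂ => B₂ (conj w)) {w : ℂ | conj w ∈ ({z : ℂ | 1 / 2 < z.re ∧ z.im < 0} ∩ Metric.ball (0 : ℂ) (n + 2) ∩ U) \ P})
    (hB₃ : DifferentiableOn ℂ B₃ (({z : ℂ | 1 / 2 < z.re ∧ z.im < 0} ∩ Metric.ball (0 : ℂ) (n + 2) ∩ U) \ P))
    (hB₃₂ : ∀ z ∈ ({z : ℂ | 1 / 2 < z.re ∧ z.im < 0} ∩ Metric.ball (0 : ℂ) (n + 2) ∩ U) \ P, B₃ z = conj (B₂ z))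
    (hB₄₁ : ∀ z' ∈ ({z : ℂ | 1 / 2 < z.re ∧ z.im < 0} ∩ Metric.ball (0 : ℂ) (n + 2) ∩ U) \ P,
      DifferentiableOn ℂ (fun z : ℂ => B₄ z z') (({z : ℂ | 1 / 2 < z.re ∧ z.im < 0} ∩ Metric.ball (0 : ℂ) (n + 2) ∩ U) \ P))
    (hB₄₂ : ∀ z ∈ ({z : ℂ | 1 / 2 < z.re ∧ z.im < 0} ∩ Metric.ball (0 : ℂ) (n + 2) ∩ U) \ P,
      DifferentiableOn ℂ (fun w : ℂ => B₄ z (conj w)) {w : ℂ | conj w ∈ ({z : ℂ | 1 / 2 < z.re ∧ z.im < 0} ∩ Metric.ball (0 : ℂ) (n + 2) ∩ U) \ P})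
    (hB₄d : ∀ z ∈ ({z : ℂ | 1 / 2 < z.re ∧ z.im < 0} ∩ Metric.ball (0 : ℂ) (n + 2) ∩ U) \ P, B₄ z z = ((b z : ℝ) : ℂ))
    (hCS : ∀ z ∈ ({z : ℂ | 1 / 2 < z.re ∧ z.im < 0} ∩ Metric.ball (0 : ℂ) (n + 2) ∩ U) \ P, ‖B₂ z‖ ^ 2 ≤ a * b z)
    -- the section, the continued series with (E1), the row-15 family on `D₁`
    (φ : (quasiSplit (↥(maximalRealSubfield L)) L (IsCMField.complexConj L) 2).Adelic → ℂ)
    (Ec : ℂ → (quasiSplit (↥(maximalRealSubfield L)) L (IsCMField.complexConj L) 2).Adelic → ℂ) (hE1 : ∀ z : ℂ, 1 < z.re → Ec z = eisensteinSeriesU (flatSectionU φ z))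
    (Fam : ℂ → Lp ℂ 2 μ) (hFd : DifferentiableOn ℂ Fam (({z : ℂ | 1 / 2 < z.re ∧ z.im < 0} ∩ Metric.ball (0 : ℂ) (n + 2) ∩ U) \ P))
    (hFam : ∀ z ∈ ({z : ℂ | 1 / 2 < z.re ∧ z.im < 0} ∩ Metric.ball (0 : ℂ) (n + 2) ∩ U) \ P,
      ((Fam z : Lp ℂ 2 μ) : (quasiSplit (↥(maximalRealSubfield L)) L (IsCMField.complexConj L) 2).automorphicQuotient → ℂ) =ᵐ[μ]
        (quasiSplit (↥(maximalRealSubfield L)) L (IsCMField.complexConj L) 2).quotFun (truncation ν 𝓕 T₀ (Ec z)))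
    -- FILE 1's `(χ, τ)` Maass–Selberg relation on the tube, in bracket letters
    (h4 : ∀ z z' : ℂ, 1 < z'.re → z'.re < z.re →
      ∫ x, (quasiSplit (↥(maximalRealSubfield L)) L (IsCMField.complexConj L) 2).quotFun (truncation ν 𝓕 T₀ (eisensteinSeriesU (flatSectionU φ z))) x * conj ((quasiSplit (↥(maximalRealSubfield L)) L (IsCMField.complexConj L) 2).quotFun (truncation ν 𝓕 T₀ (eisensteinSeriesU (flatSectionU φ z'))) x) ∂μ =
      ((cμ : ℝ) : ℂ) * (((K : ℝ) : ℂ) *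
        ((((T₀ : ℝ) : ℂ) ^ (z + conj z' - 1) / (z + conj z' - 1)) * B₁
          + (((T₀ : ℝ) : ℂ) ^ (z - conj z') / (z - conj z')) * B₂ z'
          - (((T₀ : ℝ) : ℂ) ^ (-(z - conj z')) / (z - conj z')) * B₃ z
          - (((T₀ : ℝ) : ℂ) ^ (-(z + conj z' - 1)) / (z + conj z' - 1)) * B₄ z z'))) :
    ∀ z ∈ ({z : ℂ | 1 / 2 < z.re ∧ z.im < 0} ∩ Metric.ball (0 : ℂ) (n + 2) ∩ U) \ P,
      Real.sqrt (b z) ≤ (z.re - 1 / 2) * (T₀ : ℝ) ^ (2 * (z.re - 1 / 2)) * Real.sqrt a / |z.im| +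
          Real.sqrt ((z.re - 1 / 2) ^ 2 * (T₀ : ℝ) ^ (4 * (z.re - 1 / 2)) * a / z.im ^ 2 + a * (T₀ : ℝ) ^ (4 * (z.re - 1 / 2))) ∧
        (∀ {x₁ x₂ η : ℝ}, 0 < x₁ → (z.re - 1 / 2) ∈ Set.Icc x₁ x₂ → 0 < η → η ≤ |z.im| →
          b z ≤ (x₂ * (T₀ : ℝ) ^ (2 * x₂) * Real.sqrt a / η + Real.sqrt (x₂ ^ 2 * (T₀ : ℝ) ^ (4 * x₂) * a / η ^ 2 + a * (T₀ : ℝ) ^ (4 * x₂))) ^ 2) ∧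
        (|z.im| ≤ 1 → b z ≤ ((z.re - 1 / 2) * (T₀ : ℝ) ^ (2 * (z.re - 1 / 2)) * Real.sqrt a +
          Real.sqrt ((z.re - 1 / 2) ^ 2 * (T₀ : ℝ) ^ (4 * (z.re - 1 / 2)) * a + a * (T₀ : ℝ) ^ (4 * (z.re - 1 / 2)))) ^ 2 / z.im ^ 2) := by
  -- the domain `D₁ = C ∖ S`, `C := D⁺ ∩ D_n` open convex, `S := (D_n ∖ U) ∪ P` countable
  set D₁ : Set ℂ := ({z : ℂ | 1 / 2 < z.re ∧ z.im < 0} ∩ Metric.ball (0 : ℂ) (n + 2) ∩ U) \ P with hD₁def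
  set C : Set ℂ := {z : ℂ | 1 / 2 < z.re ∧ z.im < 0} ∩ Metric.ball (0 : ℂ) (n + 2) with hCdef
  set S : Set ℂ := (Metric.ball (0 : ℂ) (n + 2) \ U) ∪ P with hSdef
  have hQo : IsOpen {z : ℂ | 1 / 2 < z.re ∧ z.im < 0} := (isOpen_lt continuous_const Complex.continuous_re).inter (isOpen_lt Complex.continuous_im continuous_const)
  have hCo : IsOpen C := hQo.inter Metric.isOpen_ball
  have hCc : Convex ℝ C := ((convex_halfSpace_re_gt (1 / 2)).inter (convex_halfSpace_im_lt 0)).inter (convex_ball (0 : ℂ) (n + 2))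
  have hSc : S.Countable := (countable_ball_diff_of_codiscrete hUcod).union hPcount
  have hDCS : D₁ = C \ S := by
    ext z
    simp only [hD₁def, hCdef, hSdef, Set.mem_sdiff, Set.mem_inter_iff, Set.mem_union, not_or, not_and, not_not]
    constructor
    · rintro ⟨⟨⟨hq, hb⟩, hU⟩, hP⟩
      exact ⟨⟨hq, hb⟩, fun _ => hU, hP⟩
    · rintro ⟨⟨hq, hb⟩, hU, hP⟩
      exact ⟨⟨⟨hq, hb⟩, hU hb⟩, hP⟩
  have hD₁o : IsOpen D₁ := (hCo.inter hUo).sdiff hPc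
  have hD₁c : IsPreconnected D₁ := by
    rw [hDCS]
    exact isPreconnected_convex_diff_of_countable Literature.Topology.Euclidean.one_lt_rank_real_complex hCc hCo hSc
  have hD₁sub : D₁ ⊆ {z : ℂ | 1 / 2 < z.re ∧ z.im < 0} := fun z hz => hz.1.1.1
  -- the boxes
  have hn' : (2 : ℝ) ≤ n := by exact_mod_cast hn
  have hdense : Dense Sᶜ := hSc.dense_compl ℝ
  have hbox : ∀ (a₁ b₁ : ℝ) (w : ℂ), a₁ < w.re → w.re < b₁ → -1 < w.im → w.im < 0 → 1 / 2 < w.re → ‖w‖ < n + 2 →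
      IsOpen (D₁ ∩ {z : ℂ | (a₁ < z.re ∧ z.re < b₁) ∧ (-1 < z.im ∧ z.im < 0)}) ∧ (D₁ ∩ {z : ℂ | (a₁ < z.re ∧ z.re < b₁) ∧ (-1 < z.im ∧ z.im < 0)}).Nonempty := by
    intro a₁ b₁ w h1 h2 h3 h4 h5 h6
    have hBo : IsOpen {z : ℂ | (a₁ < z.re ∧ z.re < b₁) ∧ (-1 < z.im ∧ z.im < 0)} :=
      ((isOpen_lt continuous_const Complex.continuous_re).inter (isOpen_lt Complex.continuous_re continuous_const)).inter
        ((isOpen_lt continuous_const Complex.continuous_im).inter (isOpen_lt Complex.continuous_im continuous_const))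
    refine ⟨hD₁o.inter hBo, ?_⟩
    have hwC : w ∈ C ∩ {z : ℂ | (a₁ < z.re ∧ z.re < b₁) ∧ (-1 < z.im ∧ z.im < 0)} := ⟨⟨⟨h5, h4⟩, mem_ball_zero_iff.2 h6⟩, ⟨h1, h2⟩, ⟨h3, h4⟩⟩
    obtain ⟨z, ⟨hzC, hzB⟩, hzS⟩ := hdense.inter_open_nonempty _ (hCo.inter hBo) ⟨w, hwC⟩
    refine ⟨z, ⟨?_, hzB⟩⟩
    rw [hDCS]
    exact ⟨hzC, hzS⟩
  have hw₁ : ‖(⟨31 / 10, -(1 / 10)⟩ : ℂ)‖ < n + 2 :=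
    lt_of_le_of_lt (Complex.norm_le_abs_re_add_abs_im _) (by norm_num [abs_of_pos, abs_of_neg]; linarith)
  have hw₂ : ‖(⟨11 / 10, -(1 / 10)⟩ : ℂ)‖ < n + 2 :=
    lt_of_le_of_lt (Complex.norm_le_abs_re_add_abs_im _) (by norm_num [abs_of_pos, abs_of_neg]; linarith)
  obtain ⟨hO₁o, hO₁ne⟩ := hbox 3 4 ⟨31 / 10, -(1 / 10)⟩ (by norm_num) (by norm_num) (by norm_num) (by norm_num) (by norm_num) hw₁
  obtain ⟨hO₂o, hO₂ne⟩ := hbox 1 2 ⟨11 / 10, -(1 / 10)⟩ (by norm_num) (by norm_num) (by norm_num) (by norm_num) (by norm_num) hw₂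
  have hsep : ∀ z ∈ D₁ ∩ {z : ℂ | (3 < z.re ∧ z.re < 4) ∧ (-1 < z.im ∧ z.im < 0)}, ∀ z' ∈ D₁ ∩ {z : ℂ | (1 < z.re ∧ z.re < 2) ∧ (-1 < z.im ∧ z.im < 0)}, 1 < z'.re ∧ z'.re < z.re :=
    fun z hz z' hz' => ⟨hz'.2.1.1, by linarith [hz'.2.1.2, hz.2.1.1]⟩
  -- the tube identity of the family
  have hFtube : ∀ z ∈ D₁, 1 < z.re → ((Fam z : Lp ℂ 2 μ) : (quasiSplit (↥(maximalRealSubfield L)) L (IsCMField.complexConj L) 2).automorphicQuotient → ℂ) =ᵐ[μ]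
      (quasiSplit (↥(maximalRealSubfield L)) L (IsCMField.complexConj L) 2).quotFun (truncation ν 𝓕 T₀ (eisensteinSeriesU (flatSectionU φ z))) := by
    intro z hz hz2
    rw [← hE1 z hz2]
    exact hFam z hz
  intro z hz
  exact poleControl_continued_chi_cm_two_of_truncatedFamily_lower_on' L hD₁o hD₁c hD₁sub hO₁o hO₁ne Set.inter_subset_left hO₂o hO₂ne Set.inter_subset_left hsep
    μ ν 𝓕 hT₀ hcμ hK ha hb hB₁ hB₂ hB₃ hB₃₂ hB₄₁ hB₄₂ hB₄d hCS φ Fam hFd hFtube h4 hz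

/-! ## §3 The bracket is bounded near every point of `D⁻ ∩ D_n` -/

/-- **THE `(χ, τ)` BRACKET `b(z)` IS BOUNDED ON A PUNCTURED NEIGHBOURHOOD OF EVERY `z₁ ∈ D⁻ ∩ D_n`** (pole or not): §2 ∘ §1 with the co-discreteness of `U` and of `P` — the mirror of ★
`K2E1ChiEisensteinNoComplexPoleCMTwo.chi_eventually_bracket_le_near_cm_two`. [cite: MoeglinWaldspurger1995, IV.3.12 (a)] [cite: BernsteinLapid2019, Thm 2.3, §4] -/
theorem chi_eventually_bracket_le_near_lower_cm_two
    (μ : Measure (quasiSplit (↥(maximalRealSubfield L)) L (IsCMField.complexConj L) 2).automorphicQuotient)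
    (ν : Measure ↥(adelicUnipotent (↥(maximalRealSubfield L)) L (IsCMField.complexConj L) 2)) (𝓕 : Set ↥(adelicUnipotent (↥(maximalRealSubfield L)) L (IsCMField.complexConj L) 2))
    (n : ℕ) (hn : 2 ≤ n) {U : Set ℂ} (hUo : IsOpen U) (hUcod : ∀ z₀ ∈ Metric.ball (0 : ℂ) (n + 2), ∀ᶠ s in 𝓝[≠] z₀, s ∈ U)
    {P : Set ℂ} (hPc : IsClosed P) (hPcount : P.Countable) (hPcod : ∀ z₀ : ℂ, ∀ᶠ s in 𝓝[≠] z₀, s ∉ P)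
    {T₀ : ℝ≥0} (hT₀ : 1 ≤ T₀) {cμ K : ℝ} (hcμ : 0 < cμ) (hK : 0 < K) {a : ℝ} (ha : 0 < a) {b : ℂ → ℝ}
    (hb : ∀ z ∈ ({z : ℂ | 1 / 2 < z.re ∧ z.im < 0} ∩ Metric.ball (0 : ℂ) (n + 2) ∩ U) \ P, 0 ≤ b z)
    {B₁ : ℂ} {B₂ B₃ : ℂ → ℂ} {B₄ : ℂ → ℂ → ℂ} (hB₁ : B₁ = ((a : ℝ) : ℂ))
    (hB₂ : DifferentiableOn ℂ (fun w : ℂ => B₂ (conj w)) {w : ℂ | conj w ∈ ({z : ℂ | 1 / 2 < z.re ∧ z.im < 0} ∩ Metric.ball (0 : ℂ) (n + 2) ∩ U) \ P})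
    (hB₃ : DifferentiableOn ℂ B₃ (({z : ℂ | 1 / 2 < z.re ∧ z.im < 0} ∩ Metric.ball (0 : ℂ) (n + 2) ∩ U) \ P))
    (hB₃₂ : ∀ z ∈ ({z : ℂ | 1 / 2 < z.re ∧ z.im < 0} ∩ Metric.ball (0 : ℂ) (n + 2) ∩ U) \ P, B₃ z = conj (B₂ z))
    (hB₄₁ : ∀ z' ∈ ({z : ℂ | 1 / 2 < z.re ∧ z.im < 0} ∩ Metric.ball (0 : ℂ) (n + 2) ∩ U) \ P,
      DifferentiableOn ℂ (fun z : ℂ => B₄ z z') (({z : ℂ | 1 / 2 < z.re ∧ z.im < 0} ∩ Metric.ball (0 : ℂ) (n + 2) ∩ U) \ P))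
    (hB₄₂ : ∀ z ∈ ({z : ℂ | 1 / 2 < z.re ∧ z.im < 0} ∩ Metric.ball (0 : ℂ) (n + 2) ∩ U) \ P,
      DifferentiableOn ℂ (fun w : ℂ => B₄ z (conj w)) {w : ℂ | conj w ∈ ({z : ℂ | 1 / 2 < z.re ∧ z.im < 0} ∩ Metric.ball (0 : ℂ) (n + 2) ∩ U) \ P})
    (hB₄d : ∀ z ∈ ({z : ℂ | 1 / 2 < z.re ∧ z.im < 0} ∩ Metric.ball (0 : ℂ) (n + 2) ∩ U) \ P, B₄ z z = ((b z : ℝ) : ℂ))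
    (hCS : ∀ z ∈ ({z : ℂ | 1 / 2 < z.re ∧ z.im < 0} ∩ Metric.ball (0 : ℂ) (n + 2) ∩ U) \ P, ‖B₂ z‖ ^ 2 ≤ a * b z)
    (φ : (quasiSplit (↥(maximalRealSubfield L)) L (IsCMField.complexConj L) 2).Adelic → ℂ)
    (Ec : ℂ → (quasiSplit (↥(maximalRealSubfield L)) L (IsCMField.complexConj L) 2).Adelic → ℂ) (hE1 : ∀ z : ℂ, 1 < z.re → Ec z = eisensteinSeriesU (flatSectionU φ z))
    (Fam : ℂ → Lp ℂ 2 μ) (hFd : DifferentiableOn ℂ Fam (({z : ℂ | 1 / 2 < z.re ∧ z.im < 0} ∩ Metric.ball (0 : ℂ) (n + 2) ∩ U) \ P))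
    (hFam : ∀ z ∈ ({z : ℂ | 1 / 2 < z.re ∧ z.im < 0} ∩ Metric.ball (0 : ℂ) (n + 2) ∩ U) \ P,
      ((Fam z : Lp ℂ 2 μ) : (quasiSplit (↥(maximalRealSubfield L)) L (IsCMField.complexConj L) 2).automorphicQuotient → ℂ) =ᵐ[μ]
        (quasiSplit (↥(maximalRealSubfield L)) L (IsCMField.complexConj L) 2).quotFun (truncation ν 𝓕 T₀ (Ec z)))
    (h4 : ∀ z z' : ℂ, 1 < z'.re → z'.re < z.re →
      ∫ x, (quasiSplit (↥(maximalRealSubfield L)) L (IsCMField.complexConj L) 2).quotFun (truncation ν 𝓕 T₀ (eisensteinSeriesU (flatSectionU φ z))) x * conj ((quasiSplit (↥(maximalRealSubfield L)) L (IsCMField.complexConj L) 2).quotFun (truncation ν 𝓕 T₀ (eisensteinSeriesU (flatSectionU φ z'))) x) ∂μ =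
      ((cμ : ℝ) : ℂ) * (((K : ℝ) : ℂ) *
        ((((T₀ : ℝ) : ℂ) ^ (z + conj z' - 1) / (z + conj z' - 1)) * B₁
          + (((T₀ : ℝ) : ℂ) ^ (z - conj z') / (z - conj z')) * B₂ z'
          - (((T₀ : ℝ) : ℂ) ^ (-(z - conj z')) / (z - conj z')) * B₃ z
          - (((T₀ : ℝ) : ℂ) ^ (-(z + conj z' - 1)) / (z + conj z' - 1)) * B₄ z z')))
    {z₁ : ℂ} (hz₁ : 1 / 2 < z₁.re ∧ z₁.im < 0) (hz₁b : z₁ ∈ Metric.ball (0 : ℂ) (n + 2)) :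
    ∃ C : ℝ, ∀ᶠ z in 𝓝[≠] z₁, b z ≤ C := by
  have hMS := chiPoleExclusion_bounds_lower_cm_two L μ ν 𝓕 n hn hUo hUcod hPc hPcount hT₀ hcμ hK ha hb hB₁ hB₂ hB₃ hB₃₂ hB₄₁ hB₄₂ hB₄d hCS φ Ec hE1 Fam hFd hFam h4
  have hQo : IsOpen ({z : ℂ | 1 / 2 < z.re ∧ z.im < 0} ∩ Metric.ball (0 : ℂ) (n + 2)) :=
    ((isOpen_lt continuous_const Complex.continuous_re).inter (isOpen_lt Complex.continuous_im continuous_const)).inter Metric.isOpen_ball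
  have hev : ∀ᶠ z in 𝓝[≠] z₁, z ∈ ({z : ℂ | 1 / 2 < z.re ∧ z.im < 0} ∩ Metric.ball (0 : ℂ) (n + 2) ∩ U) \ P := by
    filter_upwards [mem_nhdsWithin_of_mem_nhds (hQo.mem_nhds ⟨hz₁, hz₁b⟩), hUcod z₁ hz₁b, hPcod z₁] with z hzC hzU hzP
    exact ⟨⟨hzC, hzU⟩, hzP⟩
  exact exists_eventually_le_of_boxBound_of_im_ne_zero (fun z hz => (hMS z hz).2.1) ⟨hz₁.1, hz₁.2.ne⟩ hev

end Head

end Summit.HodgeConjecture.HodgeConjecture.Cruxes.H413.K2E1ChiEisensteinPoleExclusionLowerCMTwo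

end
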